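import Summits.CriticalPhenomena.CardyFormulaZ2.Theorems.CardyComplexConeParafermionToSLESixFamiliesDiamondTraceSideLayers
import Literature.Probability.Percolation.QuadCrossingPathCrossings
import HarnessLib

/-!
# The chart of a straight side: lattice coordinates `(layerFn j, layerFn (j+1))`, the frame ordinate of mesh points
# and face centres, and `proj` / `infDist` along an oriented boundary segment (line `potential-darboux-picard-diamond`, S1‴)

Crux `ParafermionToSLESixFamilies` (stmt-CriticalPhenomena-11389), line `potential-darboux-picard-diamond`, stub
`stub_exactPotentialTracePh3` (S1‴, the assembly of (DIR)/(LOW)). The landed layer files (`…DiamondTraceLayers`,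
`…DiamondTraceSideLayers`) read the lattice near side `k` of a marked diamond off the ACROSS coordinate
`re((δx − c)e′) = (δ/√2)·layerFn j x + X₀` (`j = k + 2`, frame `e′ = exp(-iπ/4)·sideFrame k`). The assembly also needs the
ALONG coordinate and the dictionary between the statement's `proj`, `infDist (·) (segment ℝ p q)`, `ctr` and these
lattice coordinates. This file supplies them:

* `exists_im_tilt_sideFrame_eq_layerFn` — the frame ordinate of `δx` is `(δ/√2)·layerFn (k + 3) x + Y₀`
  (`k + 3 = j + 1`): the pair `(layerFn j, layerFn (j+1))` is a lattice chart (`eq_of_layerFn_eq`, parity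
  `layerFn_add_layerFn_succ_even`), in which the unit steps `u_j, u_{j+1}, u_{j+2}, u_{j+3}` read
  `(−1,−1), (1,−1), (1,1), (−1,1)` (`layerFn_cornerUnit`, `layerFn_succ_cornerUnit`);
* the chain `x − i(u_j + u_{j+1})` of a side reads `(A, B) ↦ (A, B + 2i)` (`layerFn_chainSite`,
  `layerFn_succ_chainSite`, `eq_chainSite_of_layerFn`);
* `re_tilt_ctr`, `im_tilt_ctr` — the centre of the face `f` sits at `(layerFn j f + layerTop j − 1,
  layerFn (j+1) f + layerTop (j+1) − 1)` in the chart;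
* for two points `p, q` of a side line `re = a` of a unimodular frame `e` with ordinates `Yp < Yq`: `‖q − p‖ = Yq − Yp`,
  `proj p q z = im((z − c)e) − Yp` (`proj_eq_im_sub`), `infDist w [p,q] ≤ |re((w−c)e) − a|` when the ordinate of `w`
  lies in `[Yp, Yq]` (`infDist_segment_le_abs_re`), and conversely a point within `d` of `[p, q]` and `η`-away from
  `p, q` has `|re − a| ≤ d` and ordinate in `[Yp + η − 2d, Yq − η + 2d]` (`tilt_bounds_of_near_segment`, registered).

Elementary; nothing cited.
-/

noncomputable section

namespace Summit.CriticalPhenomena.CardyFormulaZ2.Cruxes.ParafermionToSLESixFamilies.PotentialDarbouxPicardDiamond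

open Set Metric Complex
open Literature.Probability Literature.Probability.LatticeModels Literature.Probability.Percolation
open Literature.Probability.LatticeModels.DiscreteDobrushin
open Literature.Probability.RandomPlanarGeometry

/-! ## The lattice chart `(layerFn j, layerFn (j + 1))` -/

/-- The along-steps of the four unit vectors: `layerFn (j+1) (u_{j+m}) = −1, −1, 1, 1`. -/
theorem layerFn_succ_cornerUnit (j m : Fin 4) : layerFn (j + 1) (cornerUnit (j + m)) = ![-1, -1, 1, 1] m := by
  revert j m; decide

/-- The along-coordinate of the `(j+m)`-th neighbour. -/
theorem layerFn_succ_add_cornerUnit (j m : Fin 4) (x : Site 2) :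
    layerFn (j + 1) (x + cornerUnit (j + m)) = layerFn (j + 1) x + ![-1, -1, 1, 1] m := by
  rw [layerFn_add, layerFn_succ_cornerUnit]

/-- The layer of the diagonal `e₀ + e₁`: `2·layerTop j − 2`. -/
theorem layerFn_diag (j : Fin 4) : layerFn j (Pi.single 0 1 + Pi.single 1 1) = 2 * layerTop j - 2 := by
  revert j; decide

/-- The layer function is `ℤ`-linear. -/
theorem layerFn_zsmul (j : Fin 4) (N : ℤ) (v : Site 2) : layerFn j (N • v) = N * layerFn j v := by
  fin_cases j <;> simp [layerFn] <;> ring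

/-- **The pair `(layerFn j, layerFn (j+1))` is a chart of `ℤ²`.** -/
theorem eq_of_layerFn_eq (j : Fin 4) {x y : Site 2} (hA : layerFn j x = layerFn j y)
    (hB : layerFn (j + 1) x = layerFn (j + 1) y) : x = y := by
  ext i
  fin_cases j <;> fin_cases i <;> simp [layerFn] at hA hB ⊢ <;> omega

/-- The two chart coordinates have the same parity. -/
theorem layerFn_add_layerFn_succ_even (j : Fin 4) (x : Site 2) : ∃ m : ℤ, layerFn j x + layerFn (j + 1) x = 2 * m := by
  fin_cases j
  · exact ⟨-x 0, by simp [layerFn]; ring⟩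
  · exact ⟨-x 1, by simp [layerFn]; ring⟩
  · exact ⟨x 0, by simp [layerFn]; ring⟩
  · exact ⟨x 1, by simp [layerFn]; ring⟩

/-- Two sites on the same layer whose along-coordinates differ by less than `2` coincide. -/
theorem eq_of_layerFn_eq_of_abs_lt (j : Fin 4) {x y : Site 2} (hA : layerFn j x = layerFn j y)
    (hB : |layerFn (j + 1) x - layerFn (j + 1) y| < 2) : x = y := by
  obtain ⟨m, hm⟩ := layerFn_add_layerFn_succ_even j x
  obtain ⟨m', hm'⟩ := layerFn_add_layerFn_succ_even j y
  refine eq_of_layerFn_eq j hA ?_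
  rw [abs_lt] at hB
  omega

/-! ## The chain of a side -/

/-- The chain step of the `i`-th chain site `x − i·(u_j + u_{j+1})` of orientation `j` started at `x`. -/
theorem chainSite_succ (j : Fin 4) (x : Site 2) (i : ℕ) :
    x - ((i + 1 : ℕ) : ℤ) • (cornerUnit j + cornerUnit (j + 1)) =
      x - (i : ℤ) • (cornerUnit j + cornerUnit (j + 1)) - cornerUnit j - cornerUnit (j + 1) := by
  simp only [Nat.cast_add, Nat.cast_one, add_smul, one_smul]
  abel

/-- The chain keeps the layer. -/
theorem layerFn_chainSite (j : Fin 4) (x : Site 2) (i : ℕ) :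
    layerFn j (x - (i : ℤ) • (cornerUnit j + cornerUnit (j + 1))) = layerFn j x := by
  induction i with
  | zero => simp
  | succ i ih => rw [chainSite_succ, layerFn_chainStep, ih]

/-- The chain advances by `2` per step along the side. -/
theorem layerFn_succ_chainSite (j : Fin 4) (x : Site 2) (i : ℕ) :
    layerFn (j + 1) (x - (i : ℤ) • (cornerUnit j + cornerUnit (j + 1))) = layerFn (j + 1) x + 2 * i := by
  induction i with
  | zero => simp
  | succ i ih =>
    have h0 := layerFn_succ_cornerUnit j 0
    have h1 := layerFn_succ_cornerUnit j 1
    simp only [add_zero, Matrix.cons_val_zero, Matrix.cons_val_one] at h0 h1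
    rw [chainSite_succ, layerFn_sub, layerFn_sub, ih, h0, h1]
    push_cast
    ring

/-- The chain is injective. -/
theorem chainSite_injective (j : Fin 4) (x : Site 2) :
    Function.Injective (fun i : ℕ => x - (i : ℤ) • (cornerUnit j + cornerUnit (j + 1))) := by
  intro i i' h
  have := congrArg (layerFn (j + 1)) h
  simp only at this
  rw [layerFn_succ_chainSite, layerFn_succ_chainSite] at this
  exact_mod_cast (show (i : ℤ) = i' by omega)

/-- **A site of the layer of `x`, `2i` further along, is the `i`-th chain site.** -/
theorem eq_chainSite_of_layerFn (j : Fin 4) {x y : Site 2} {i : ℕ} (hA : layerFn j y = layerFn j x)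
    (hB : layerFn (j + 1) y = layerFn (j + 1) x + 2 * i) : y = x - (i : ℤ) • (cornerUnit j + cornerUnit (j + 1)) :=
  eq_of_layerFn_eq j (by rw [hA, layerFn_chainSite]) (by rw [hB, layerFn_succ_chainSite])

/-! ## The frame ordinate of mesh points and of face centres -/

/-- **The along-coordinate of side `k`**: in the frame `exp(-iπ/4) · sideFrame k` the ordinate of the mesh point `δx`
is `(δ/√2) · layerFn (k + 3) x + Y₀` (and `k + 3 = (k + 2) + 1` is the successor of the orientation `j = k + 2`). -/
theorem exists_im_tilt_sideFrame_eq_layerFn (δ : ℝ) (c : ℂ) (k : Fin 4) : ∃ Y₀ : ℝ, ∀ x : Site 2,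
    ((meshPoint δ x - c) * (exp (-(Real.pi / 4 : ℝ) * I) * sideFrame k)).im =
      Real.sqrt 2 / 2 * δ * layerFn (k + 3) x + Y₀ := by
  fin_cases k
  · refine ⟨-(Real.sqrt 2 / 2 * (c.re + c.im)), fun x => ?_⟩
    obtain ⟨h1, -⟩ := tilt_meshPoint δ c x
    have hs : sideFrame 0 = I := by simp [sideFrame]
    simp only [Fin.zero_eta, Fin.isValue, hs, ← mul_assoc, mul_I_im, h1]
    simp [layerFn]; ring
  · refine ⟨-(Real.sqrt 2 / 2 * (c.im - c.re)), fun x => ?_⟩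
    obtain ⟨-, h2⟩ := tilt_meshPoint δ c x
    have hs : sideFrame 1 = 1 := by simp [sideFrame]
    simp only [Fin.mk_one, Fin.isValue, hs, mul_one, h2]
    simp [layerFn]; ring
  · refine ⟨Real.sqrt 2 / 2 * (c.re + c.im), fun x => ?_⟩
    obtain ⟨h1, -⟩ := tilt_meshPoint δ c x
    have hs : sideFrame 2 = -I := by simp [sideFrame]
    simp only [Fin.reduceFinMk, Fin.isValue, hs, ← mul_assoc, mul_neg, neg_im, mul_I_im, h1]
    simp [layerFn]; ring
  · refine ⟨Real.sqrt 2 / 2 * (c.im - c.re), fun x => ?_⟩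
    obtain ⟨-, h2⟩ := tilt_meshPoint δ c x
    have hs : sideFrame 3 = -1 := by simp [sideFrame]
    simp only [Fin.reduceFinMk, Fin.isValue, hs, mul_neg, mul_one, neg_im, h2]
    simp [layerFn]; ring

/-- The centre of a face in a frame: the midpoint of the two diagonal corners. -/
theorem tilt_ctr (δ : ℝ) (c e : ℂ) (f : Site 2) : (ctr δ f - c) * e =
    (1 / 2 : ℂ) * ((meshPoint δ f - c) * e) + (1 / 2 : ℂ) * ((meshPoint δ (f + Pi.single 0 1 + Pi.single 1 1) - c) * e) := by
  rw [ctr_eq_midpoint, real_smul, real_smul]; push_cast; ring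

/-- **The across-coordinate of a face centre**: `(δ/√2)·(layerFn j f + layerTop j − 1) + X₀`. -/
theorem re_tilt_ctr {δ : ℝ} {c e : ℂ} {j : Fin 4} {X₀ : ℝ}
    (hX : ∀ x : Site 2, ((meshPoint δ x - c) * e).re = Real.sqrt 2 / 2 * δ * layerFn j x + X₀) (f : Site 2) :
    ((ctr δ f - c) * e).re = Real.sqrt 2 / 2 * δ * (layerFn j f + layerTop j - 1) + X₀ := by
  have h := layerFn_diag j
  have e1 : ((1 / 2 : ℂ) * ((meshPoint δ f - c) * e)).re = 1 / 2 * ((meshPoint δ f - c) * e).re := by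
    simp [mul_re]
  have e2 : ((1 / 2 : ℂ) * ((meshPoint δ (f + Pi.single 0 1 + Pi.single 1 1) - c) * e)).re =
      1 / 2 * ((meshPoint δ (f + Pi.single 0 1 + Pi.single 1 1) - c) * e).re := by
    simp [mul_re]
  rw [tilt_ctr, add_re, e1, e2, hX, hX, add_assoc f, layerFn_add, h]
  push_cast; ring

/-- **The along-coordinate of a face centre**: `(δ/√2)·(layerFn (j+1) f + layerTop (j+1) − 1) + Y₀`. -/
theorem im_tilt_ctr {δ : ℝ} {c e : ℂ} {j : Fin 4} {Y₀ : ℝ}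
    (hY : ∀ x : Site 2, ((meshPoint δ x - c) * e).im = Real.sqrt 2 / 2 * δ * layerFn (j + 1) x + Y₀) (f : Site 2) :
    ((ctr δ f - c) * e).im = Real.sqrt 2 / 2 * δ * (layerFn (j + 1) f + layerTop (j + 1) - 1) + Y₀ := by
  have h := layerFn_diag (j + 1)
  have e1 : ((1 / 2 : ℂ) * ((meshPoint δ f - c) * e)).im = 1 / 2 * ((meshPoint δ f - c) * e).im := by
    simp [mul_im]
  have e2 : ((1 / 2 : ℂ) * ((meshPoint δ (f + Pi.single 0 1 + Pi.single 1 1) - c) * e)).im =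
      1 / 2 * ((meshPoint δ (f + Pi.single 0 1 + Pi.single 1 1) - c) * e).im := by
    simp [mul_im]
  rw [tilt_ctr, add_im, e1, e2, hY, hY, add_assoc f, layerFn_add, h]
  push_cast; ring

/-! ## Two points of a side line: `proj`, `‖q − p‖`, `infDist` in the frame -/

section Chart

variable {c e : ℂ} (he : ‖e‖ = 1) {p q : ℂ} {a Yp Yq : ℝ} (hpX : ((p - c) * e).re = a) (hqX : ((q - c) * e).re = a)
  (hpY : ((p - c) * e).im = Yp) (hqY : ((q - c) * e).im = Yq)

/-- Differences in the frame. -/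
theorem tilt_sub_eq (z w : ℂ) : (z - w) * e = (z - c) * e - (w - c) * e := by ring

include he in
/-- A unimodular frame: `e · conj e = 1`. -/
theorem frame_mul_conj : e * (starRingEnd ℂ) e = 1 := by
  rw [mul_conj, normSq_eq_norm_sq, he]; norm_num

include hpX hqX hpY hqY in
/-- `(q − p)e = i (Yq − Yp)`. -/
theorem tilt_q_sub_p : (q - p) * e = ((Yq - Yp : ℝ) : ℂ) * I := by
  apply Complex.ext
  · rw [tilt_sub_eq, sub_re, hpX, hqX]; simp
  · rw [tilt_sub_eq, sub_im, hpY, hqY]; simp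

include he hpX hqX hpY hqY in
/-- `‖q − p‖ = Yq − Yp` for `Yp ≤ Yq`. -/
theorem norm_q_sub_p (hle : Yp ≤ Yq) : ‖q - p‖ = Yq - Yp := by
  have h : ‖(q - p) * e‖ = ‖q - p‖ := by rw [norm_mul, he, mul_one]
  rw [← h, tilt_q_sub_p hpX hqX hpY hqY, norm_mul, norm_I, mul_one, norm_real, Real.norm_eq_abs,
    abs_of_nonneg (by linarith)]

include he hpX hqX hpY hqY in
/-- **`proj` is the frame ordinate**: `proj p q z = im((z − c)e) − Yp` (for `Yp < Yq`). -/
theorem proj_eq_im_sub (hlt : Yp < Yq) (z : ℂ) : proj p q z = ((z - c) * e).im - Yp := by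
  have hce := frame_mul_conj he
  have hzp : z - p = ((z - p) * e) * (starRingEnd ℂ) e := by rw [mul_assoc, hce, mul_one]
  have hqp : q - p = (((Yq - Yp : ℝ) : ℂ) * I) * (starRingEnd ℂ) e := by
    rw [← tilt_q_sub_p hpX hqX hpY hqY, mul_assoc, hce, mul_one]
  have hprod : (z - p) * (starRingEnd ℂ) (q - p) = ((z - p) * e) * (-I) * ((Yq - Yp : ℝ) : ℂ) := by
    conv_lhs => rw [hzp, hqp]
    rw [map_mul, map_mul, Complex.conj_conj, Complex.conj_I, Complex.conj_ofReal]
    calc (z - p) * e * (starRingEnd ℂ) e * (((Yq - Yp : ℝ) : ℂ) * -I * e)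
        = (z - p) * e * -I * ((Yq - Yp : ℝ) : ℂ) * (e * (starRingEnd ℂ) e) := by ring
      _ = (z - p) * e * -I * ((Yq - Yp : ℝ) : ℂ) := by rw [hce, mul_one]
  unfold proj
  rw [norm_q_sub_p he hpX hqX hpY hqY hlt.le, hprod, re_mul_ofReal, mul_neg, neg_re, mul_I_re, neg_neg,
    tilt_sub_eq (c := c), sub_im, hpY, mul_div_assoc, div_self (by linarith : (Yq - Yp) ≠ 0), mul_one]

include hpX hqX hpY hqY in
/-- Points of the segment in the frame: abscissa `a`, ordinate in `[Yp, Yq]`, at distance `ordinate − Yp` from `p`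
along the frame. -/
theorem tilt_of_mem_segment' (hle : Yp ≤ Yq) {z : ℂ} (hz : z ∈ segment ℝ p q) :
    ((z - c) * e).re = a ∧ Yp ≤ ((z - c) * e).im ∧ ((z - c) * e).im ≤ Yq ∧
      ∃ θ : ℝ, 0 ≤ θ ∧ θ ≤ 1 ∧ z = p + θ • (q - p) ∧ ((z - c) * e).im = Yp + θ * (Yq - Yp) := by
  rw [segment_eq_image' ℝ p q] at hz
  obtain ⟨θ, ⟨hθ0, hθ1⟩, rfl⟩ := hz
  obtain ⟨hre, him⟩ := tilt_param c e p q θ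
  rw [hpX, hqX, sub_self, mul_zero, add_zero] at hre
  rw [hpY, hqY] at him
  refine ⟨hre, ?_, ?_, θ, hθ0, hθ1, rfl, him⟩
  · rw [him]; nlinarith
  · rw [him]; nlinarith

include he hpX hqX hpY hqY in
/-- **A point whose ordinate lies in `[Yp, Yq]` is within `|abscissa − a|` of the segment.** -/
theorem infDist_segment_le_abs_re (hlt : Yp < Yq) {w : ℂ} (h1 : Yp ≤ ((w - c) * e).im) (h2 : ((w - c) * e).im ≤ Yq) :
    infDist w (segment ℝ p q) ≤ |((w - c) * e).re - a| := by
  set θ : ℝ := (((w - c) * e).im - Yp) / (Yq - Yp) with hθ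
  have hθ0 : 0 ≤ θ := div_nonneg (by linarith) (by linarith)
  have hθ1 : θ ≤ 1 := (div_le_one (by linarith)).2 (by linarith)
  set z : ℂ := p + θ • (q - p) with hz
  have hzmem : z ∈ segment ℝ p q := by rw [segment_eq_image' ℝ p q]; exact ⟨θ, ⟨hθ0, hθ1⟩, rfl⟩
  obtain ⟨hre, him⟩ := tilt_param c e p q θ
  rw [hpX, hqX, sub_self, mul_zero, add_zero] at hre
  rw [hpY, hqY] at him
  have himw : ((z - c) * e).im = ((w - c) * e).im := by
    rw [hz, him, hθ, div_mul_cancel₀ _ (by linarith : (Yq - Yp) ≠ 0)]; ring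
  refine (infDist_le_dist_of_mem hzmem).trans (le_of_eq ?_)
  rw [dist_eq_norm_tilt_sub c e he, norm_eq_abs_re_of_im_eq_zero (by rw [sub_im, himw, sub_self]), sub_re, hre]

include he hpY in
/-- The distance to `p` dominates the ordinate difference. -/
theorem abs_im_sub_le_dist_p (w : ℂ) : |((w - c) * e).im - Yp| ≤ dist w p := by
  rw [← hpY, dist_eq_norm]; exact abs_im_tilt_sub_le c e he w p

include he hqY in
/-- The distance to `q` dominates the ordinate difference. -/
theorem abs_im_sub_le_dist_q (w : ℂ) : |((w - c) * e).im - Yq| ≤ dist w q := by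
  rw [← hqY, dist_eq_norm]; exact abs_im_tilt_sub_le c e he w q

include he hpX hqX hpY hqY in
/-- **A point near the segment, in the frame**: within `d` of `[p, q]` and `η`-away from `p` and `q` forces
`|abscissa − a| ≤ d` and ordinate in `[Yp + η − 2d, Yq − η + 2d]`. -/
theorem tilt_bounds_of_near (hle : Yp ≤ Yq) {w : ℂ} {d η : ℝ} (hw : infDist w (segment ℝ p q) ≤ d)
    (hp : η ≤ dist w p) (hq : η ≤ dist w q) :
    |((w - c) * e).re - a| ≤ d ∧ Yp + η - 2 * d ≤ ((w - c) * e).im ∧ ((w - c) * e).im ≤ Yq - η + 2 * d := by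
  obtain ⟨z, hz, hzd⟩ := (isCompact_segment_complex p q).exists_infDist_eq_dist ⟨p, left_mem_segment ℝ p q⟩ w
  have hwz : dist w z ≤ d := hzd ▸ hw
  obtain ⟨hzre, -, -, θ, hθ0, hθ1, hzθ, hzim⟩ := tilt_of_mem_segment' hpX hqX hpY hqY hle hz
  obtain ⟨hdp, hdq⟩ := dist_param p q hθ0 hθ1
  rw [← hzθ, norm_q_sub_p he hpX hqX hpY hqY hle] at hdp hdq
  have hzp : η - d ≤ dist z p := by linarith [dist_triangle w z p]
  have hzq : η - d ≤ dist z q := by linarith [dist_triangle w z q]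
  rw [hdp] at hzp
  rw [hdq] at hzq
  rw [dist_eq_norm] at hwz
  have hre := abs_le.1 ((abs_re_tilt_sub_le c e he w z).trans hwz)
  have him := abs_le.1 ((abs_im_tilt_sub_le c e he w z).trans hwz)
  rw [hzre] at hre
  rw [hzim] at him
  refine ⟨abs_le.2 ⟨hre.1, hre.2⟩, ?_, ?_⟩ <;> nlinarith

include he hpX hqX hpY hqY in
/-- A point within `d` of the segment has `|abscissa − a| ≤ d` and ordinate in `[Yp − d, Yq + d]`. -/
theorem tilt_bounds_of_infDist_le (hle : Yp ≤ Yq) {w : ℂ} {d : ℝ} (hw : infDist w (segment ℝ p q) ≤ d) :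
    |((w - c) * e).re - a| ≤ d ∧ Yp - d ≤ ((w - c) * e).im ∧ ((w - c) * e).im ≤ Yq + d := by
  obtain ⟨z, hz, hzd⟩ := (isCompact_segment_complex p q).exists_infDist_eq_dist ⟨p, left_mem_segment ℝ p q⟩ w
  have hwz : dist w z ≤ d := hzd ▸ hw
  obtain ⟨hzre, hz1, hz2, -⟩ := tilt_of_mem_segment' hpX hqX hpY hqY hle hz
  rw [dist_eq_norm] at hwz
  have hre := abs_le.1 ((abs_re_tilt_sub_le c e he w z).trans hwz)
  have him := abs_le.1 ((abs_im_tilt_sub_le c e he w z).trans hwz)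
  rw [hzre] at hre
  refine ⟨abs_le.2 ⟨hre.1, hre.2⟩, ?_, ?_⟩ <;> linarith

end Chart

/-- **The frame bounds of a point near a piece of a side line** (registered helper of `stub_exactPotentialTracePh3`):
for a unimodular frame `e`, two points `p, q` with frame abscissa `a` and ordinates `Yp ≤ Yq`, every point within `d`
of `[p, q]` and at distance `≥ η` from `p` and from `q` has frame abscissa within `d` of `a` and ordinate in
`[Yp + η − 2d, Yq − η + 2d]`; and `proj p q` is the frame ordinate minus `Yp` when `Yp < Yq`. -/
theorem tilt_bounds_of_near_segment : ∀ (c e : ℂ), ‖e‖ = 1 → ∀ (p q : ℂ) (a Yp Yq : ℝ), ((p - c) * e).re = a → ((q - c) * e).re = a → ((p - c) * e).im = Yp → ((q - c) * e).im = Yq → Yp ≤ Yq → (∀ (w : ℂ) (d η : ℝ), infDist w (segment ℝ p q) ≤ d → η ≤ dist w p → η ≤ dist w q → |((w - c) * e).re - a| ≤ d ∧ Yp + η - 2 * d ≤ ((w - c) * e).im ∧ ((w - c) * e).im ≤ Yq - η + 2 * d) ∧ (Yp < Yq → ∀ z : ℂ, proj p q z = ((z - c) * e).im - Yp) := by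
  intro c e he p q a Yp Yq hpX hqX hpY hqY hle
  exact ⟨fun w d η hw hp hq => tilt_bounds_of_near he hpX hqX hpY hqY hle hw hp hq,
    fun hlt z => proj_eq_im_sub he hpX hqX hpY hqY hlt z⟩

end Summit.CriticalPhenomena.CardyFormulaZ2.Cruxes.ParafermionToSLESixFamilies.PotentialDarbouxPicardDiamond

end
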